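import Summits.AnomalousDissipation.AnomalousDissipation.Theorems.BaireTransferDenseLoudDesignerForcesStubLoudInvariantMeasure
import Summits.AnomalousDissipation.AnomalousDissipation.Theorems.BaireTransferDenseLoudDesignerForcesStubOrbitClosure

/-!
# Krylov–Bogolyubov with budgets ON THE ORBIT CLOSURE of a loud trajectory (line `ergodic-budget-selection-closing`,
# crux `BaireTransfer.DenseLoudDesignerForces`, stmt-AnomalousDissipation-1143) — Stub KB′ of skeleton v8

Sorry-free discharge of the registered stub `stub_loudInvariantMeasure_orbitClosure` (fourth lead c3-0, 2026-08-16): the landed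
Krylov–Bogolyubov stub `stub_loudInvariantMeasure` (p109397, `…StubLoudInvariantMeasure.lean`: generalized time averages along loud times +
Riesz–Markov–Kakutani + vanishing boundary terms + enstrophy continuity on `K`) applied to the sub-phase `IsNSPhase.orbitClosure`
(`…StubOrbitClosure.lean`): a loud trajectory of an NS phase yields an invariant probability measure with `ensembleEnergy ≤ E`,
`ensembleDissipation ≥ ε` carried by the CLOSURE OF ITS OWN FORWARD ORBIT.  Consequently the residual of the line (Stub 1′, trajectory
form) only has to make the chaotic hypothesis for the LOUD invariant measures carried by that orbit closure — "the loud statistics of one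
bounded strong trajectory are hyperbolic".

References: Foias–Manley–Rosa–Temam, *Navier–Stokes Equations and Turbulence* (CUP 2001) Ch. IV §2.1 Def. 2.1, §3.1 Prop. 3.1
(time-average measures of one trajectory are stationary statistical solutions); N. Kryloff, N. Bogoliouboff, Ann. of Math. 38 (1937).
-/

set_option linter.dupNamespace false

noncomputable section

open scoped BigOperators Topology ENNReal InnerProductSpace
open Filter Set Function MeasureTheory

namespace Summit.AnomalousDissipation.AnomalousDissipation.Theorems.DenseLoudDesignerForces.Ergodic

open Literature.Analysis.FunctionSpaces Literature.Analysis.FunctionSpaces.Torus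
open Literature.Analysis.FluidPDE Literature.Analysis.FluidPDE.Torus
open Summit.AnomalousDissipation.AnomalousDissipation.Theses.BaireTransfer
open Summit.AnomalousDissipation.AnomalousDissipation.Theorems.DenseLoudDesignerForces.Negative

section OrbitClosureKB

/-- **Stub KB′ of the line `ergodic-budget-selection-closing`: KRYLOV–BOGOLYUBOV WITH BUDGETS ON THE ORBIT CLOSURE.**  If a trajectory
of the NS phase `(K, φ)` starting at `x ∈ K` has time-mean energy `≤ E` for all large times and time-mean dissipation `≥ ε` for
arbitrarily large times, then the CLOSURE OF ITS FORWARD ORBIT carries an invariant probability measure `μ` (invariant under every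
`φ_t`, `t ≥ 0`) with `ensembleEnergy μ ≤ E` and `ensembleDissipation ν μ ≥ ε` — the landed `stub_loudInvariantMeasure` applied to the
sub-phase `IsNSPhase.orbitClosure`.  Consequently the chaotic hypothesis of the residual is only needed for the loud invariant measures
carried by the orbit closure of the loud trajectory.
[cite: FMRTTurbulence2001, Ch. IV §2.1 Def. 2.1, §3.1 Prop. 3.1 (time-average measures of one trajectory are stationary statistical solutions)] -/
theorem stub_loudInvariantMeasure_orbitClosure {ν : ℝ} {F : (UnitAddTorus (Fin 3)) → (EuclideanSpace ℝ (Fin 3))} {K : Set Hsp}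
    {φ : ℝ → Hsp → Hsp} (hK : IsNSPhase ν F K φ) {x : Hsp} (hx : x ∈ K) {E ε : ℝ}
    (hE : ∀ᶠ T in atTop, energyAvg φ x T ≤ E) (hε : ∃ᶠ T in atTop, ε ≤ dissipAvg ν φ x T) :
    ∃ μ : Measure Hsp, IsInvariantMeasure (closure ((fun t : ℝ => φ t x) '' Ici 0)) φ μ ∧
      ensembleEnergy μ ≤ E ∧ ε ≤ ensembleDissipation ν μ :=
  stub_loudInvariantMeasure (hK.orbitClosure hx) (hK.mem_orbitClosure_self hx) hE hε

end OrbitClosureKB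

end Summit.AnomalousDissipation.AnomalousDissipation.Theorems.DenseLoudDesignerForces.Ergodic

end
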